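import Mathlib.Tactic
import HarnessLib

/-!
# Kozma–Nitzan's Question 8 — THEOREM JL: the positive-emission sum `JL′` is below the out-defect `c` (gen 37)

Support file (`--supports stmt-CriticalPhenomena-4575`, closed crux; independent mathematics on Kozma–Nitzan's Question 8,
arXiv:2401.12397 §5.5 p. 36), prover `prim-ineq-gen-6` (gen 37).  No definitions, no named facts, no sorries; standard axioms.
Memo `run/shared/lean/prim/prim-ineq-gen-6/PROOF-JL-G37.md`.

THEOREM QA-GEN (gen 33, …KnQuestion8QAGen.lean) reduces the corner condition `(Q-A)` of every path-end block to
`UNIF-I` (gen 36) and `JL′ ≤ c`, where `JL′ = Σ_{j≤i} g_j·[θ_i(1+λ_i) − θ_j]⁺` is the sum of the positive emissions of the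
block weighted by the θ-brackets of the last positive depth `i = k₁ − 1`.  THEOREM JL (this file's kernels + the memo's three
block facts) proves `JL′ < c` for EVERY block:
* `kJL_collapse`: since `θ_j·A_(j,i] = θ_i·C_(j,i]` and `A_(j,i] ≤ 1`, every bracket is at most `θ_i·(λ_i + (1 − C_(j,i]))`,
  and `1 − C_(j,i] ≤ 1 − γ_i` (the C-defect of the whole prefix); `kJL_sum` sums this: `JL′ ≤ θ_i(λ_i + 1 − γ_i)·P₊`.
* the three block facts (earlier gens, recalled in the memo): the emission law `P₊ ≤ c(1−S_{i+1})/(a_iS_{i+1})` (THEOREM UB,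
  gen 28), the quantitative positive region `1 − γ_i < a_i²S_{i+1}/3` (PROOF-SSC-U REMARK (iv), gen 27) and the near-mass bound
  `m ≥ (1−S_{i+1})·Φ·a_iγ_i` (`kJL_near_mass` turns it into `λ_i ≤ a_iS_{i+1}/(1+(1−S_{i+1})a_iγ_i)`).
* `kJL_scalar_base`, `kJL_scalar`: the resulting 3-variable inequality
  `(1−S)·(a/(1+(1−S)aγ) + a²/3) ≤ γ − 1/6` on `{3(1−γ) ≤ a²S}`; `kJL_final` assembles `JL′ < c`.
Exact link checks on path-end blocks: lab-g37/h37a_jl_chain.py (0 failures; sup JL′/c = 0.497).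
[cite: KozmaNitzan2024, Question 8 (§5.5 p. 36)]
-/

namespace Summit.CriticalPhenomena.PercolationContinuityZ3.Theorems

namespace PocketCert

open Finset

/-- **θ-collapse of one bracket.**  With `θ_j·At = θ_i·Ct` (`At = A_(j,i]`, `Ct = C_(j,i]`, so `θ_i = θ_j·At/Ct`),
`0 < At ≤ 1`, `0 ≤ Ct ≤ 1`, `0 ≤ θ_i`, `0 ≤ λ`:  `[θ_i(1+λ) − θ_j]⁺ ≤ θ_i·(λ + (1 − Ct))`.
[cite: KozmaNitzan2024, Question 8 (§5.5 p. 36)] -/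
theorem kJL_collapse (thi thj At Ct lam : ℝ) (hth : thj * At = thi * Ct) (hAt0 : 0 < At) (hAt1 : At ≤ 1)
    (hCt0 : 0 ≤ Ct) (hCt1 : Ct ≤ 1) (hthi : 0 ≤ thi) (hlam : 0 ≤ lam) :
    max (thi * (1 + lam) - thj) 0 ≤ thi * (lam + (1 - Ct)) := by
  have hthj0 : 0 ≤ thj := by
    have h : 0 ≤ thj * At := by rw [hth]; exact mul_nonneg hthi hCt0
    exact nonneg_of_mul_nonneg_left h hAt0
  have hthj : thi * Ct ≤ thj := by
    nlinarith [mul_le_mul_of_nonneg_left hAt1 hthj0]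
  apply max_le
  · nlinarith
  · nlinarith

/-- **θ-collapse, summed.**  If every bracket satisfies `Br_j ≤ θ_i(λ + c_j)` with `c_j ≤ cg` (the prefix C-defect `1 − γ_i`)
and the emissions `g_j` are nonnegative, then `Σ g_j·Br_j ≤ θ_i·(λ + cg)·Σ g_j`.
[cite: KozmaNitzan2024, Question 8 (§5.5 p. 36)] -/
theorem kJL_sum (J : Finset ℕ) (g Br cdef : ℕ → ℝ) (thi lam cg : ℝ) (hthi : 0 ≤ thi)
    (hg : ∀ j ∈ J, 0 ≤ g j) (hBr : ∀ j ∈ J, Br j ≤ thi * (lam + cdef j)) (hc : ∀ j ∈ J, cdef j ≤ cg) :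
    ∑ j ∈ J, g j * Br j ≤ thi * (lam + cg) * ∑ j ∈ J, g j := by
  rw [Finset.mul_sum]
  apply Finset.sum_le_sum
  intro j hj
  have h1 := hg j hj
  have h2 := hBr j hj
  have h3 := hc j hj
  have h4 : Br j ≤ thi * (lam + cg) := by nlinarith [mul_le_mul_of_nonneg_left h3 hthi]
  nlinarith [mul_le_mul_of_nonneg_left h4 h1]

/-- **Near-mass bound in ratio form.**  `λ_i(Φ+m) = a_iΦS_{i+1}` and `m ≥ (1−S_{i+1})Φ·a_iγ_i` (the classes cut inside the
prefix carry both-good mass at least `a_iγ_i·Φ`) give `λ_i·(1 + (1−S)a_iγ_i) ≤ a_i·S`.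
[cite: KozmaNitzan2024, Question 8 (§5.5 p. 36)] -/
theorem kJL_near_mass (lam Φ m a S γ : ℝ) (hΦ : 0 < Φ) (hlam0 : 0 ≤ lam)
    (hlam : lam * (Φ + m) = a * Φ * S) (hm : (1 - S) * Φ * a * γ ≤ m) :
    lam * (1 + (1 - S) * a * γ) ≤ a * S := by
  have h1 : lam * (Φ * (1 + (1 - S) * a * γ)) ≤ lam * (Φ + m) := by
    apply mul_le_mul_of_nonneg_left _ hlam0
    nlinarith
  rw [hlam] at h1
  have h2 : Φ * (lam * (1 + (1 - S) * a * γ)) ≤ Φ * (a * S) := by nlinarith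
  exact le_of_mul_le_mul_left h2 hΦ

/-- **Scalar lemma, base case** (`γ` at its minimum `1 − a²(1−t)/3`): for `a, t ∈ [0,1]`,
`15 − 6a² − 3ta − 11ta³ + 2ta⁵ + 5t²a³ − 2t²a⁵ ≥ 0`
(`= 6(1−a²) + 3(1−ta) + t(11−5t)(1−a³) + (1−t)(6−5t) + 2ta⁵(1−t)`).
[cite: KozmaNitzan2024, Question 8 (§5.5 p. 36)] -/
theorem kJL_scalar_base (a t : ℝ) (ha0 : 0 ≤ a) (ha1 : a ≤ 1) (ht0 : 0 ≤ t) (ht1 : t ≤ 1) :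
    0 ≤ 15 - 6 * a ^ 2 - 3 * t * a - 11 * t * a ^ 3 + 2 * t * a ^ 5 + 5 * t ^ 2 * a ^ 3 - 2 * t ^ 2 * a ^ 5 := by
  have ha3 : a ^ 3 ≤ 1 := by nlinarith [pow_le_one₀ ha0 ha1 (n := 3)]
  have e : 15 - 6 * a ^ 2 - 3 * t * a - 11 * t * a ^ 3 + 2 * t * a ^ 5 + 5 * t ^ 2 * a ^ 3 - 2 * t ^ 2 * a ^ 5
      = 6 * (1 - a ^ 2) + 3 * (1 - t * a) + t * (11 - 5 * t) * (1 - a ^ 3) + (1 - t) * (6 - 5 * t)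
        + 2 * t * a ^ 5 * (1 - t) := by ring
  rw [e]
  have h1 : 0 ≤ 1 - a ^ 2 := by nlinarith
  have h2 : 0 ≤ 1 - t * a := by nlinarith
  have h3 : 0 ≤ t * (11 - 5 * t) * (1 - a ^ 3) := by
    apply mul_nonneg
    · apply mul_nonneg ht0; linarith
    · linarith
  have h4 : 0 ≤ (1 - t) * (6 - 5 * t) := by apply mul_nonneg <;> linarith
  have h5 : 0 ≤ 2 * t * a ^ 5 * (1 - t) := by
    apply mul_nonneg
    · positivity
    · linarith
  linarith

/-- **Scalar lemma.**  For `a, t ∈ [0,1]` and `3(1−γ) ≤ a²(1−t)` (the quantitative positive region with `t = 1 − S`):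
`6ta + 2a²t(1 + taγ) ≤ (6γ − 1)(1 + taγ)`, i.e. `t·(a/(1+taγ) + a²/3) ≤ γ − 1/6`.
Proof: the difference is increasing in `γ`; at the minimal `γ` it is `kJL_scalar_base / 3`.
[cite: KozmaNitzan2024, Question 8 (§5.5 p. 36)] -/
theorem kJL_scalar (a t γ : ℝ) (ha0 : 0 ≤ a) (ha1 : a ≤ 1) (ht0 : 0 ≤ t) (ht1 : t ≤ 1)
    (hγ : 3 * (1 - γ) ≤ a ^ 2 * (1 - t)) :
    6 * t * a + 2 * a ^ 2 * t * (1 + t * a * γ) ≤ (6 * γ - 1) * (1 + t * a * γ) := by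
  set g0 : ℝ := 1 - a ^ 2 * (1 - t) / 3 with hg0
  have hgg0 : g0 ≤ γ := by rw [hg0]; linarith
  have hbase := kJL_scalar_base a t ha0 ha1 ht0 ht1
  -- F(γ) = F(g0) + (γ - g0) * (6 + 6 t a (γ + g0) - t a - 2 a^3 t^2)
  have eF : (6 * γ - 1) * (1 + t * a * γ) - (6 * t * a + 2 * a ^ 2 * t * (1 + t * a * γ))
      = ((6 * g0 - 1) * (1 + t * a * g0) - (6 * t * a + 2 * a ^ 2 * t * (1 + t * a * g0)))
        + (γ - g0) * (6 + 6 * t * a * (γ + g0) - t * a - 2 * a ^ 3 * t ^ 2) := by ring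
  have eF0 : (6 * g0 - 1) * (1 + t * a * g0) - (6 * t * a + 2 * a ^ 2 * t * (1 + t * a * g0))
      = (15 - 6 * a ^ 2 - 3 * t * a - 11 * t * a ^ 3 + 2 * t * a ^ 5 + 5 * t ^ 2 * a ^ 3 - 2 * t ^ 2 * a ^ 5) / 3 := by
    rw [hg0]; ring
  have hta : t * a ≤ 1 := by nlinarith
  have hta0 : 0 ≤ t * a := mul_nonneg ht0 ha0
  have hg0pos : 0 ≤ g0 := by
    rw [hg0]
    have : a ^ 2 * (1 - t) ≤ 1 := by nlinarith
    linarith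
  have hγ0 : 0 ≤ γ := le_trans hg0pos hgg0
  have hbr : 0 ≤ 6 + 6 * t * a * (γ + g0) - t * a - 2 * a ^ 3 * t ^ 2 := by
    have h1 : a ^ 3 * t ^ 2 ≤ 1 := by
      have : a ^ 3 ≤ 1 := pow_le_one₀ ha0 ha1
      have : t ^ 2 ≤ 1 := by nlinarith
      nlinarith [pow_nonneg ha0 3, sq_nonneg t]
    have h2 : 0 ≤ 6 * t * a * (γ + g0) := by positivity
    linarith
  have hprod : 0 ≤ (γ - g0) * (6 + 6 * t * a * (γ + g0) - t * a - 2 * a ^ 3 * t ^ 2) :=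
    mul_nonneg (by linarith) hbr
  have : 0 ≤ (6 * γ - 1) * (1 + t * a * γ) - (6 * t * a + 2 * a ^ 2 * t * (1 + t * a * γ)) := by
    rw [eF, eF0]; positivity
  linarith

/-- **THEOREM JL, assembly.**  Data of the last positive depth `i` of a path-end block (`a = a_i`, `γ = γ_i`, `S = S_{i+1}`,
`λ = λ_i`, `P = P₊ = Σ_{j≤i} g_j`, `JL = JL′`): the θ-collapse `JL·γ ≤ a(λ + 1 − γ)P`, the emission law `P·aS ≤ c(1−S)`,
the near-mass bound in ratio form `λ(1+(1−S)aγ) ≤ aS` and the quantitative positive region `3(1−γ) < a²S` give `JL < c`.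
[cite: KozmaNitzan2024, Question 8 (§5.5 p. 36)] -/
theorem kJL_final (JL P c a γ S lam : ℝ) (hc : 0 < c) (ha0 : 0 < a) (ha1 : a ≤ 1) (hγ0 : 0 < γ) (hγ1 : γ ≤ 1)
    (hS0 : 0 < S) (hS1 : S ≤ 1) (hlam0 : 0 ≤ lam)
    (hJL : JL * γ ≤ a * (lam + (1 - γ)) * P) (hE : P * (a * S) ≤ c * (1 - S))
    (hmass : lam * (1 + (1 - S) * a * γ) ≤ a * S) (hQ : 3 * (1 - γ) < a ^ 2 * S) :
    JL < c := by
  have ht0 : 0 ≤ 1 - S := by linarith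
  have ht1 : 1 - S ≤ 1 := by linarith
  have hD0 : 0 < 1 + (1 - S) * a * γ := by positivity
  -- step 1: JL γ S ≤ (lam + 1 - γ) c (1 - S)
  have hk : 0 ≤ lam + (1 - γ) := by linarith
  have h1 : JL * γ * S ≤ (lam + (1 - γ)) * (c * (1 - S)) := by
    have e1 : JL * γ * S ≤ a * (lam + (1 - γ)) * P * S := by nlinarith [mul_le_mul_of_nonneg_right hJL hS0.le]
    have e2 := mul_le_mul_of_nonneg_left hE hk
    nlinarith
  -- step 2: (lam + (1-γ)) * 3 D ≤ 3 a S + a^2 S D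
  have h2 : (lam + (1 - γ)) * (3 * (1 + (1 - S) * a * γ)) ≤ 3 * a * S + a ^ 2 * S * (1 + (1 - S) * a * γ) := by
    nlinarith
  -- step 3: scalar lemma with t = 1 - S
  have hQ' : 3 * (1 - γ) ≤ a ^ 2 * (1 - (1 - S)) := by linarith
  have h3 := kJL_scalar a (1 - S) γ ha0.le ha1 ht0 ht1 hQ'
  -- combine
  have h4 : JL * γ * S * (3 * (1 + (1 - S) * a * γ)) ≤ c * (1 - S) * (3 * a * S + a ^ 2 * S * (1 + (1 - S) * a * γ)) := by
    have e3 := mul_le_mul_of_nonneg_left h2 (show 0 ≤ c * (1 - S) by positivity)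
    have e4 := mul_le_mul_of_nonneg_right h1 (show 0 ≤ 3 * (1 + (1 - S) * a * γ) by positivity)
    nlinarith
  have h5 : c * (1 - S) * (3 * a * S + a ^ 2 * S * (1 + (1 - S) * a * γ))
      ≤ c * S * ((6 * γ - 1) * (1 + (1 - S) * a * γ)) / 2 := by
    have e5 := mul_le_mul_of_nonneg_left h3 (show 0 ≤ c * S by positivity)
    have e6 : c * (1 - S) * (3 * a * S + a ^ 2 * S * (1 + (1 - S) * a * γ))
        = c * S * (6 * (1 - S) * a + 2 * a ^ 2 * (1 - S) * (1 + (1 - S) * a * γ)) / 2 := by ring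
    rw [e6]
    linarith
  have h6 : c * S * ((6 * γ - 1) * (1 + (1 - S) * a * γ)) / 2 < c * γ * S * (3 * (1 + (1 - S) * a * γ)) := by
    have : 0 < c * S * (1 + (1 - S) * a * γ) := by positivity
    nlinarith
  have h7 : JL * (γ * S * (3 * (1 + (1 - S) * a * γ))) < c * (γ * S * (3 * (1 + (1 - S) * a * γ))) := by
    have e1 : JL * (γ * S * (3 * (1 + (1 - S) * a * γ))) = JL * γ * S * (3 * (1 + (1 - S) * a * γ)) := by ring
    have e2 : c * (γ * S * (3 * (1 + (1 - S) * a * γ))) = c * γ * S * (3 * (1 + (1 - S) * a * γ)) := by ring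
    rw [e1, e2]; linarith
  have hpos : 0 < γ * S * (3 * (1 + (1 - S) * a * γ)) := by positivity
  exact lt_of_mul_lt_mul_right h7 hpos.le

end PocketCert

end Summit.CriticalPhenomena.PercolationContinuityZ3.Theorems
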